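import Summits.HodgeConjecture.CorCM.DecicWeil23MultiFrameTransfer
import Summits.HodgeConjecture.CorCM.Census.DecicWeil23MultiExtraction
import Summits.HodgeConjecture.CorCM.CMWeightPullbackSubproduct
import HarnessLib

/-!
# COR-CM — any number `r` of `(2,3)`-types over one decic CM field: the Weil SIXFOLD parts (one curve point + the five labels of `B_m`
# of one sign) of a weight of any product of copies of `E, B₁, …, B_r` have algebraic lines, GIVEN the Weil planes of `B_m × E`

Cell `pub-hodgecm2` (COR-CM), seat b30 gen 24 (2026-08-22); count-neutral own lane DECIC-MULTI.  Theorems + one bookkeeping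
definition (the sub-product `foldM m`); no named fact, no `sorry`.  The slot-generic twin of `CorCM/DecicWeil23TripleSixfoldParts`
(same proofs, atoms `Y = E ⊞ B₁ ⊞ ⋯ ⊞ B_r` on `multiSlots r`).  The Weil plane of `(B_m × E, ι(iδ) × ι(δ))` enters as the HYPOTHESIS
`hW m` (discharged downstream from `Markman2025_weilClasses_algebraic_hyperbolicSixfold` by seat b09's
`DecicCurveFivefold.weilClassesOf_le_algebraicClasses_cmFivefold_prod_cmCurve_of_markmanSixfold` and gen 22's type count
`DecicWeil23Triple.typeCount_eq_three_of_reading₅`).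

* §1 `foldM m = (m+1, 0)` (the sub-product `B_m ⊞ E` of `Y`);
* §2 `apply_eq_of_signM` — sign ⟹ eigenvalue `±i√d` on the family `(δ; iδ, …, iδ)`;
* §3 `weightClassesAlg_three_le_algebraicClasses_of_signM` — a six-point weight of `B_m ⊞ E` of constant sign lies in a Weil
  eigenline (`PairWeights.weightClassesAlg_le_weilClassesPlus/Minus`), algebraic by `hW m` transported to `⨁`;
* §4 **`weightClassesAlg_le_algebraicClasses_of_isSixPartM`** — ANY slot map `κ : Fin N → Fin (r+1)`: project the part to `Y`
  (injective), pull back from the sub-product (`CMWeights.weightClassesAlg_map_le_algebraicClasses`) and lift along `κ`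
  (distribution lemma `CMWeights.weightClassesAlg_comp_le_algebraicClasses_of_injOn`).
HONEST FRAMING: nothing about the Hodge conjecture is concluded here; `HC_CM` is not asserted.
[cite: Deligne1982HodgeCycles, §5 (c)] [cite: vanGeemen1994HodgeAV, 4.9] [cite: Milne2020HodgeClassesAV, 1.2 (a) and Thm. 1]
[cite: MoonenZarhin1995Duke, Thm. 2.4]

## References
* [Deligne1982HodgeCycles] P. Deligne, LNM 900 (1982), §5 (c).  [vanGeemen1994HodgeAV] B. van Geemen, LNM 1594 (1994), 3.6–3.7,
  4.9.  [Milne2020HodgeClassesAV] J. S. Milne, arXiv:2010.08857, 1.2 (a), Thm. 1.  [MoonenZarhin1995Duke] B. Moonen,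
  Yu. Zarhin, Duke Math. J. 77 (1995), Thm. 2.4.
-/

noncomputable section

open CategoryTheory CategoryTheory.Limits NumberField

namespace Summit.HodgeConjecture.CorCM.DecicWeil23Multi

open Literature.AlgebraicGeometry Literature.AlgebraicGeometry.Motives Literature.AlgebraicGeometry.HodgeTheory
open Literature.AlgebraicGeometry.ComplexMultiplication (IsCMTypeRealisation)
open Literature.AlgebraicGeometry.Pohlmann1968
open Literature.AlgebraicTopology.SingularHomology
open Literature.NumberTheory.ComplexMultiplication
open Summit.HodgeConjecture.CorCM.Census.DecicWeil23Multi (PtM IsSixPartM)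
open Summit.HodgeConjecture.CorCM.CMWeights (weightClassesAlg_comp_le_algebraicClasses_of_injOn
  weightClassesAlg_map_le_algebraicClasses sigma_map_injective)
open Summit.HodgeConjecture.CorCM.PairWeights

open scoped Classical

/-! ## §1 The sub-product `B_m ⊞ E` -/

/-- The two-factor sub-product `(m+1, 0)` of `Y = E ⊞ B₁ ⊞ ⋯ ⊞ B_r`: `B_m ⊞ E` (fivefold FIRST, as in seat b09's `curveSlots₂`).
[folklore] -/
def foldM {r : ℕ} (m : Fin r) : Fin 2 → Fin (r + 1) := ![m.succ, 0]

/-- `foldM m` is injective (`m + 1 ≠ 0`). [folklore] -/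
theorem foldM_injective {r : ℕ} (m : Fin r) : Function.Injective (foldM m) := by
  intro a b h
  fin_cases a <;> fin_cases b
  · rfl
  · exact absurd h (Fin.succ_ne_zero m)
  · exact absurd h.symm (Fin.succ_ne_zero m)
  · rfl

/-- The range of `foldM m` is `{m+1, 0}`. [folklore] -/
theorem mem_range_foldM {r : ℕ} {m : Fin r} {l : Fin (r + 1)} (h : l = m.succ ∨ l = 0) : l ∈ Set.range (foldM m) := by
  rcases h with rfl | rfl; exacts [⟨0, rfl⟩, ⟨1, rfl⟩]

section Sixfold

variable {I : Type} {r : ℕ} {Kf : I → Type} [∀ i, Field (Kf i)] [∀ i, NumberField (Kf i)]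
  {i₀ i₁ : I} {e : (Kf i₁ →+* ℂ) ≃ Fin 5 × Bool} {τ : Kf i₀ →+* ℂ} {i : Kf i₀ →+* Kf i₁}
  (hk : ∀ σ : Kf i₀ →+* ℂ, σ = τ ∨ σ = ComplexEmbedding.conjugate τ)
  (he_sign : ∀ s : Kf i₁ →+* ℂ, (e s).2 = true ↔ s.comp i = τ)
  {A₄ : Fin (r + 1) → AbelianVariety ℂ} {Φ₄ : ∀ j : Fin (r + 1), CMType (Kf (multiSlots r i₀ i₁ j))}
  {ι₄ : ∀ j, 𝓞 (Kf (multiSlots r i₀ i₁ j)) →+* End (A₄ j)}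
  {θ₄ : ∀ j, Kf (multiSlots r i₀ i₁ j) →+* Module.End ℂ (complexBetti (A₄ j).X 1)}
  (hA : ∀ j, IsCMTypeRealisation (Φ₄ j) (A₄ j) (ι₄ j) (θ₄ j))
  {δ : 𝓞 (Kf i₀)} {d : ℕ} (hτ : τ (δ : Kf i₀) = Complex.I * (Real.sqrt d : ℂ))

/-! ## §2 Sign ⟹ eigenvalue -/

omit [∀ i, NumberField (Kf i)] in
include hk he_sign hτ in
/-- **Sign ⟹ eigenvalue**: a point of the index set of `Y = E ⊞ B₁ ⊞ ⋯ ⊞ B_r` of sign `b` — over `inl b`, or over a label `(m, a, b)` —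
has eigenvalue `+i√d` (`b = true`) resp. `−i√d` (`b = false`) on the family `a = (δ; iδ, …, iδ)`. [cite: Deligne1982HodgeCycles, §5 (c)] -/
theorem apply_eq_of_signM (x : (l : Fin (r + 1)) × (Kf (multiSlots r i₀ i₁ l) →+* ℂ)) (b : Bool)
    (hx : toPtM e τ x = Sum.inl b ∨ ∃ (m : Fin r) (a : Fin 5), toPtM e τ x = Sum.inr (m, (a, b))) :
    x.2 (((Fin.cons δ (fun _ : Fin r => RingOfIntegers.mapRingHom i δ) :
        ∀ l : Fin (r + 1), 𝓞 (Kf (multiSlots r i₀ i₁ l))) x.1 : 𝓞 (Kf (multiSlots r i₀ i₁ x.1))) : Kf (multiSlots r i₀ i₁ x.1)) =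
      if b then Complex.I * (Real.sqrt d : ℂ) else -(Complex.I * (Real.sqrt d : ℂ)) := by
  have hconjτ : ComplexEmbedding.conjugate τ (δ : Kf i₀) = -(Complex.I * (Real.sqrt d : ℂ)) := by
    rw [ComplexEmbedding.conjugate_coe_eq, hτ, map_mul, Complex.conj_I, Complex.conj_ofReal, neg_mul]
  rcases sigma_casesM x with ⟨σ, rfl⟩ | ⟨m, s, rfl⟩
  · -- the curve slot: `σ = τ_b`
    have hσ : decide (σ = τ) = b := by
      rcases hx with h | ⟨m, a, h⟩
      · rw [toPtM_zero, Sum.inl.injEq] at h; exact h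
      · rw [toPtM_zero] at h; exact absurd h Sum.inl_ne_inr
    show σ (δ : Kf i₀) = _
    cases b
    · rw [if_neg Bool.false_ne_true, (hk σ).resolve_left (of_decide_eq_false hσ)]
      exact hconjτ
    · rw [if_pos rfl, of_decide_eq_true hσ]
      exact hτ
  · -- a fivefold slot: `(e s).2 = b`
    have hs : (e s).2 = b := by
      rcases hx with h | ⟨m', a, h⟩
      · rw [toPtM_succ] at h; exact absurd h Sum.inr_ne_inl
      · rw [toPtM_succ, Sum.inr.injEq, Prod.mk.injEq] at h
        rw [h.2]
    show s ((RingOfIntegers.mapRingHom i δ : 𝓞 (Kf i₁)) : Kf i₁) = _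
    have hmap : ((RingOfIntegers.mapRingHom i δ : 𝓞 (Kf i₁)) : Kf i₁) = i (δ : Kf i₀) := rfl
    rw [hmap]
    change (s.comp i) (δ : Kf i₀) = _
    cases b
    · rw [if_neg Bool.false_ne_true,
        (hk (s.comp i)).resolve_left fun h' => absurd ((he_sign s).2 h') (by rw [hs]; exact Bool.false_ne_true)]
      exact hconjτ
    · rw [if_pos rfl, (he_sign s).1 hs]
      exact hτ

/-! ## §3 A six-point weight of `B_m ⊞ E` of constant sign is algebraic, given the Weil plane -/

omit [∀ i, NumberField (Kf i)] in
include hk he_sign hτ in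
/-- **A six-point weight of `B_m ⊞ E` (the sub-product `foldM m` of `Y`) of constant sign has an algebraic line, GIVEN the Weil
plane of the sixfold.**  All six points have eigenvalue `±i√d` on `(iδ, δ)`, so the line lies in a Weil eigenline
(`PairWeights.weightClassesAlg_le_weilClassesPlus/Minus`) `⊆ W ⊗ ℂ`, algebraic by `hW` transported to `⨁`.
[cite: vanGeemen1994HodgeAV, 4.9] [cite: Deligne1982HodgeCycles, §5 (c)] -/
theorem weightClassesAlg_three_le_algebraicClasses_of_signM (m : Fin r)
    (hW : weilClassesOf ((A₄ m.succ).prod (A₄ 0))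
      (AbelianVariety.prodLift (AbelianVariety.fst (A₄ m.succ) (A₄ 0) ≫ ι₄ m.succ (RingOfIntegers.mapRingHom i δ))
        (AbelianVariety.snd (A₄ m.succ) (A₄ 0) ≫ ι₄ 0 δ)) 3 d ≤
      algebraicClasses ((A₄ m.succ).prod (A₄ 0)).X 3)
    (b : Bool) (T : Finset ((j : Fin 2) × (Kf (multiSlots r i₀ i₁ (foldM m j)) →+* ℂ))) (hTcard : T.card = 2 * 3)
    (hsgn : ∀ z ∈ T, toPtM e τ ⟨foldM m z.1, z.2⟩ = Sum.inl b ∨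
      ∃ (m' : Fin r) (a : Fin 5), toPtM e τ ⟨foldM m z.1, z.2⟩ = Sum.inr (m', (a, b))) :
    weightClassesAlg (fun j => A₄ (foldM m j)) (fun j => ι₄ (foldM m j)) (2 * 3) T ≤
      algebraicClasses (⨁ fun j => A₄ (foldM m j)).X 3 := by
  -- the family `(iδ, δ)` on the two slots, as the restriction of `a = (δ; iδ, …, iδ)`
  let a₃ : ∀ l : Fin (r + 1), 𝓞 (Kf (multiSlots r i₀ i₁ l)) := Fin.cons δ fun _ : Fin r => RingOfIntegers.mapRingHom i δ
  let a₂ : ∀ j : Fin 2, 𝓞 (Kf (multiSlots r i₀ i₁ (foldM m j))) := fun j => a₃ (foldM m j)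
  have hval : ∀ z ∈ T, z.2 ((a₂ z.1 : 𝓞 (Kf (multiSlots r i₀ i₁ (foldM m z.1)))) : Kf (multiSlots r i₀ i₁ (foldM m z.1))) =
      if b then Complex.I * (Real.sqrt d : ℂ) else -(Complex.I * (Real.sqrt d : ℂ)) :=
    fun z hz => apply_eq_of_signM hk he_sign hτ ⟨foldM m z.1, z.2⟩ b (hsgn z hz)
  -- the Weil plane of `⨁_j A₄(foldM m j)`, algebraic by `hW`
  have hWeil : weilClassesOf (⨁ fun j => A₄ (foldM m j)) (biproduct.map fun j => ι₄ (foldM m j) (a₂ j)) 3 d ≤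
      algebraicClasses (⨁ fun j => A₄ (foldM m j)).X 3 :=
    weilClassesOf_biproduct_le_algebraicClasses_of_prod (A := fun j => A₄ (foldM m j)) (fun j => ι₄ (foldM m j) (a₂ j)) hW
  cases b
  · refine (weightClassesAlg_le_weilClassesMinus (K := fun j => Kf (multiSlots r i₀ i₁ (foldM m j)))
      (A := fun j => A₄ (foldM m j)) (ι := fun j => ι₄ (foldM m j)) a₂ hTcard fun z hz => ?_).trans
      ((weilClassesMinus_le_weilClassesOf _ _ 3 d).trans hWeil)
    simpa using hval z hz
  · refine (weightClassesAlg_le_weilClassesPlus (K := fun j => Kf (multiSlots r i₀ i₁ (foldM m j)))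
      (A := fun j => A₄ (foldM m j)) (ι := fun j => ι₄ (foldM m j)) a₂ hTcard fun z hz => ?_).trans
      ((weilClassesPlus_le_weilClassesOf _ _ 3 d).trans hWeil)
    simpa using hval z hz

/-! ## §4 Sixfold parts of any product of copies -/

omit [∀ i, NumberField (Kf i)] in
/-- A point of `Y` whose model label is `inl b` or `(m, a, b)` lies in a slot of the sub-product `foldM m`. [folklore] -/
theorem fst_mem_range_foldM {m : Fin r} {b : Bool} {y : (l : Fin (r + 1)) × (Kf (multiSlots r i₀ i₁ l) →+* ℂ)}
    (hy : toPtM e τ y = Sum.inl b ∨ ∃ a : Fin 5, toPtM e τ y = Sum.inr (m, (a, b))) : y.1 ∈ Set.range (foldM m) := by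
  refine mem_range_foldM ?_
  rcases sigma_casesM y with ⟨σ, rfl⟩ | ⟨m', s, rfl⟩
  · exact Or.inr rfl
  · rcases hy with h | ⟨a, h⟩
    · rw [toPtM_succ] at h; exact absurd h Sum.inr_ne_inl
    · rw [toPtM_succ, Sum.inr.injEq, Prod.mk.injEq] at h
      exact Or.inl (by rw [h.1])

include hk he_sign hA hτ in
/-- **THE SIXFOLD PARTS HAVE ALGEBRAIC LINES (any slot map).**  For `κ : Fin N → Fin (r+1)` and a sixfold part `G` of slot `m`,
sign `b` of a weight of `X = ⨁_j A₄(κ j)` — one curve point over `inl b` and the five labels `(m, a, b)` — `H⁶(X)_G ⊆ N³ H⁶(X)`,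
GIVEN the Weil plane of `B_m × E` (`hW m`): the projection `P (j, s) = (κ j, s)` to `Y` is injective on `G` (one point per label),
`P(G)` is the image under `foldM m` of a six-point weight of `B_m ⊞ E` of constant sign (§3), pulled back to `Y`
(`CMWeights.weightClassesAlg_map_le_algebraicClasses`) and lifted along `κ` (distribution lemma).
[cite: Milne2020HodgeClassesAV, 1.2 (a) and Thm. 1] [cite: Deligne1982HodgeCycles, §5 (c)] -/
theorem weightClassesAlg_le_algebraicClasses_of_isSixPartM
    (hW : ∀ m : Fin r, weilClassesOf ((A₄ m.succ).prod (A₄ 0))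
      (AbelianVariety.prodLift (AbelianVariety.fst (A₄ m.succ) (A₄ 0) ≫ ι₄ m.succ (RingOfIntegers.mapRingHom i δ))
        (AbelianVariety.snd (A₄ m.succ) (A₄ 0) ≫ ι₄ 0 δ)) 3 d ≤
      algebraicClasses ((A₄ m.succ).prod (A₄ 0)).X 3)
    {N : ℕ} (κ : Fin N → Fin (r + 1)) {m : Fin r} {b : Bool} {G : Finset ((j : Fin N) × (Kf (multiSlots r i₀ i₁ (κ j)) →+* ℂ))}
    (hG : IsSixPartM (fun x => toPtM e τ ((Sigma.map κ (fun _ => id) :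
      ((j : Fin N) × (Kf (multiSlots r i₀ i₁ (κ j)) →+* ℂ)) → ((l : Fin (r + 1)) × (Kf (multiSlots r i₀ i₁ l) →+* ℂ))) x)) m b G) :
    G.card = 2 * 3 ∧ weightClassesAlg (fun j => A₄ (κ j)) (fun j => ι₄ (κ j)) (2 * 3) G ≤
      algebraicClasses (⨁ fun j => A₄ (κ j)).X 3 := by
  refine ⟨hG.1, ?_⟩
  set P : ((j : Fin N) × (Kf (multiSlots r i₀ i₁ (κ j)) →+* ℂ)) → ((l : Fin (r + 1)) × (Kf (multiSlots r i₀ i₁ l) →+* ℂ)) :=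
    Sigma.map κ (fun _ => id) with hP
  -- the projection is injective on the part
  have hinj : Set.InjOn P ↑G := fun x hx x' hx' h => hG.injOn hx hx' (by rw [h])
  set TY := G.image P with hTY
  have hTYcard : TY.card = 2 * 3 := by rw [hTY, Finset.card_image_of_injOn hinj, hG.1]
  have hTYmem : ∀ y ∈ TY, toPtM e τ y = Sum.inl b ∨ ∃ a : Fin 5, toPtM e τ y = Sum.inr (m, (a, b)) := by
    intro y hy
    obtain ⟨x, hx, rfl⟩ := Finset.mem_image.1 hy
    exact hG.mem_cases hx
  -- the sub-product weight
  set F : ((j : Fin 2) × (Kf (multiSlots r i₀ i₁ (foldM m j)) →+* ℂ)) → ((l : Fin (r + 1)) × (Kf (multiSlots r i₀ i₁ l) →+* ℂ)) :=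
    fun z => ⟨foldM m z.1, z.2⟩ with hF
  have hFinj : Function.Injective F := sigma_map_injective (K := fun l => Kf (multiSlots r i₀ i₁ l)) (foldM m) (foldM_injective m)
  set T₂ := TY.preimage F hFinj.injOn with hT₂
  have hT₂map : T₂.map ⟨F, hFinj⟩ = TY := by
    rw [Finset.map_eq_image, hT₂]
    change (TY.preimage F hFinj.injOn).image F = TY
    rw [Finset.image_preimage]
    have key : ∀ y : (l : Fin (r + 1)) × (Kf (multiSlots r i₀ i₁ l) →+* ℂ), y.1 ∈ Set.range (foldM m) → y ∈ Set.range F := by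
      rintro ⟨l, t⟩ ⟨j, rfl⟩
      exact ⟨⟨j, t⟩, rfl⟩
    refine Finset.filter_true_of_mem fun y hy => key y (fst_mem_range_foldM (hTYmem y hy))
  have hT₂card : T₂.card = 2 * 3 := by rw [← hTYcard, ← hT₂map, Finset.card_map]
  have hsgn : ∀ z ∈ T₂, toPtM e τ ⟨foldM m z.1, z.2⟩ = Sum.inl b ∨
      ∃ (m' : Fin r) (a : Fin 5), toPtM e τ ⟨foldM m z.1, z.2⟩ = Sum.inr (m', (a, b)) := by
    intro z hz
    have hz' : F z ∈ TY := Finset.mem_preimage.1 hz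
    rcases hTYmem (F z) hz' with h | ⟨a, h⟩
    · exact Or.inl h
    · exact Or.inr ⟨m, a, h⟩
  have halg₂ := weightClassesAlg_three_le_algebraicClasses_of_signM hk he_sign hτ m (hW m) b T₂ hT₂card hsgn
  -- pull back to `Y` and lift along `κ`
  have hY := weightClassesAlg_map_le_algebraicClasses (K := fun l => Kf (multiSlots r i₀ i₁ l)) (A := A₄) (Φ := Φ₄) (ι := ι₄)
    (θ := θ₄) hA (foldM m) (foldM_injective m) hT₂card halg₂
  rw [hT₂map] at hY
  exact weightClassesAlg_comp_le_algebraicClasses_of_injOn (K := fun l => Kf (multiSlots r i₀ i₁ l)) (A := A₄) (Φ := Φ₄)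
    (ι := ι₄) (θ := θ₄) hA κ hG.1 hinj hY

end Sixfold

end Summit.HodgeConjecture.CorCM.DecicWeil23Multi

end
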